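import Mathlib
import Summits.MatrixMultiplication.MatrixMultiplication.Theses.CwPowerHosting
import Literature.Combinatorics.Additive.SliceRankMethod

/-!
# Sketch — crux ideas for `CwPowerHosting.HostingRateThree` (stmt-MatrixMultiplication-15970), ideator k=2

Objects for the idea card `difference-body-thinning` (negation lens):

* `hostMap p q` — the additive hosting map `x ↦ Σ_i a_i(x_i)` of a PAIR SYSTEM `a_i = (0, p_i, q_i)`
  (the normal form every free hosting has after `AdditiveRigidity`, stmt-15973);
* `IsPairHosting p q` — the full free-hosting axiom in pair form (`a(x)+a(y)+a(z) = σ ↔ permutation pattern`);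
* `CarriesDifferenceBody p q` — the RELAXED axiom: only patterns with at least one coordinate of
  DIFFERENCE type (exactly two of `x_i, y_i, z_i` equal) are required not to vanish; patterns all of whose
  non-permutation coordinates are ONE-SIDED (`x_i = y_i = z_i`) are unconstrained;
* `threeTorsionCard H = |H[3]|` (so `|H[3]| = 3^{r₃(H)}`);
* the two stubs of the line — `Thinning` (slice rank: a rate-`3^{1+ε}` hosting has `|H[3]| ≤ 3^{δN}`) and
  `DifferenceBodyFloor` (the new floor: carrying the difference body costs `3^{(1+κ)N}` up to a power of `|H[3]|`),
  the sharp conjectured form `DifferenceBodyLaw` (`|H| ≥ 4^N (3/4)^{r₃}`, exact on every computed cell), and the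
  typed composition target `Kill`.
-/

open Finset BigOperators

set_option linter.dupNamespace false

namespace Summit.MatrixMultiplication.MatrixMultiplication.Cruxes.HostingRateThree.DifferenceBody

open Summit.MatrixMultiplication.MatrixMultiplication.Theses.CwPowerHosting

variable {H : Type} [AddCommGroup H] {N : ℕ}

/-- digits of a pair system: `a_i(0) = 0, a_i(1) = p_i, a_i(2) = q_i`. -/
def digit (p q : Fin N → H) (i : Fin N) : Fin 3 → H := ![0, p i, q i]

/-- the additive hosting map of a pair system. -/
def hostMap (p q : Fin N → H) (x : Fin N → Fin 3) : H := ∑ i, digit p q i (x i)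

/-- `σ = Σ_i (p_i + q_i)`, the value of every permutation pattern. -/
def sigma (p q : Fin N → H) : H := ∑ i, (p i + q i)

/-- coordinate `i` of the triple `(x,y,z)` is a permutation of `{0,1,2}`. -/
def PermAt (x y z : Fin N → Fin 3) (i : Fin N) : Prop := x i ≠ y i ∧ x i ≠ z i ∧ y i ≠ z i

/-- coordinate `i` is of DIFFERENCE type: exactly two of `x_i, y_i, z_i` coincide
(its value `a(x_i)+a(y_i)+a(z_i) − σ_i` is then one of `±p_i, ±q_i, ±(p_i − q_i)`). -/
def DiffAt (x y z : Fin N → Fin 3) (i : Fin N) : Prop := ¬ PermAt x y z i ∧ ¬ (x i = y i ∧ x i = z i)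

/-- full free hosting, pair form (the normal form of `HostingRateThree`'s axiom after additive rigidity). -/
def IsPairHosting (p q : Fin N → H) : Prop :=
  ∀ x y z : Fin N → Fin 3, hostMap p q x + hostMap p q y + hostMap p q z = sigma p q ↔ ∀ i, PermAt x y z i

/-- the pair system CARRIES THE DIFFERENCE BODY: every pattern with a difference-type coordinate is non-vanishing
(one-sided-only patterns may vanish). -/
def CarriesDifferenceBody (p q : Fin N → H) : Prop :=
  ∀ x y z : Fin N → Fin 3, (∃ i, DiffAt x y z i) → hostMap p q x + hostMap p q y + hostMap p q z ≠ sigma p q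

/-- `|H[3]|`, the number of elements killed by 3 (equals `3^{r₃(H)}`). -/
noncomputable def threeTorsionCard (H : Type) [AddCommGroup H] : ℕ := Nat.card {h : H // (3 : ℕ) • h = 0}

/-- FIRST LEMMA (trivial direction, sanity): a pair hosting carries the difference body. -/
theorem IsPairHosting.carriesDifferenceBody {p q : Fin N → H} (h : IsPairHosting p q) :
    CarriesDifferenceBody p q := by
  intro x y z ⟨i, hi⟩ hsum
  exact hi.1 ((h x y z).1 hsum i)

/-- STUB 1 — THINNING (slice rank).  A free hosting of the `N`-th power at rate `3^{1+ε}` lives in a group whose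
3-torsion is `3^{o(N)}`: for every `δ > 0` there are `ε > 0` and `C` with `|H[3]| ≤ C·3^{δN}` whenever
`|H| ≤ 3^{(1+ε)N}`.  Source of truth: slice rank is monotone under restriction, `SR(D_H) ≤ SR(D_{H[3]})·[H : H[3]]`
(BCCGNSU 2017 Lemma 3.5 / Prop. 4.8), `SR(D_{𝔽₃^r}) ≤ 3·2.756^r` (Ellenberg–Gijswijt / BCCGNSU Thm 4.14, PROVED in tree as
`Literature.Combinatorics.Additive.exists_tricoloredSumFree_card_le` in counting form), and `SR(xyz^{⊠N}) ≥ Q(xyz^{⊠N}) = 3^{N−o(N)}`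
(Strassen 1991, tight 3-tensors; named fact, not in tree). -/
def Thinning : Prop :=
  ∀ δ : ℝ, 0 < δ → ∃ ε : ℝ, 0 < ε ∧ ∃ C : ℝ, ∀ (N : ℕ) (H : Type) [AddCommGroup H] [Fintype H]
    (α β γ : (Fin N → Fin 3) → H),
    (∀ x y z : Fin N → Fin 3, α x + β y + γ z = 0 ↔ ∀ i, x i ≠ y i ∧ x i ≠ z i ∧ y i ≠ z i) →
    (Fintype.card H : ℝ) ≤ (3 : ℝ) ^ ((1 + ε) * N) →
    (threeTorsionCard H : ℝ) ≤ C * (3 : ℝ) ^ (δ * N)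

/-- STUB 2 — DIFFERENCE-BODY FLOOR (the new mathematics; negation of the crux follows from it and `Thinning`).
Carrying the `N`-difference body costs rate strictly above 3 once the 3-torsion is discounted polynomially. -/
def DifferenceBodyFloor : Prop :=
  ∃ κ : ℝ, 0 < κ ∧ ∃ C : ℝ, 0 ≤ C ∧ ∃ c : ℝ, 0 < c ∧ ∀ (N : ℕ) (H : Type) [AddCommGroup H] [Fintype H]
    (p q : Fin N → H), CarriesDifferenceBody p q →
    c * (3 : ℝ) ^ ((1 + κ) * N) ≤ (Fintype.card H : ℝ) * (threeTorsionCard H : ℝ) ^ C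

/-- The SHARP conjectured law behind STUB 2 (exact on every computed cell, `N ≤ 4`): a carrier of the
`N`-difference body with `|H[3]| = 3^r` has `|H| ≥ 4^N (3/4)^{min(r,N)}`; equality for `𝔽₃^r × (ℤ/4)^{N−r}`-type
designs (`r ≤ N`) and for `ℤ/(3·4^{N−1})` (`r = 1`).  In the exponent form below: `4^N ≤ |H| · |H[3]|^{log₃(4/3)}`. -/
def DifferenceBodyLaw : Prop :=
  ∀ (N : ℕ) (H : Type) [AddCommGroup H] [Fintype H] (p q : Fin N → H), CarriesDifferenceBody p q →
    (4 : ℝ) ^ N ≤ (Fintype.card H : ℝ) * (threeTorsionCard H : ℝ) ^ (Real.logb 3 (4 / 3))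

/-- glue stub (M): additive rigidity puts every free hosting in pair form inside the SAME group. -/
def PairsOfHosting : Prop :=
  ∀ (N : ℕ) (H : Type) [AddCommGroup H] [Fintype H] (α β γ : (Fin N → Fin 3) → H),
    (∀ x y z : Fin N → Fin 3, α x + β y + γ z = 0 ↔ ∀ i, x i ≠ y i ∧ x i ≠ z i ∧ y i ≠ z i) →
    ∃ p q : Fin N → H, IsPairHosting p q

/-- glue stub (M−): direct powers of a hosting (`H^k` hosts the `kN`-th power), used to push `N` past the
threshold where `Thinning` and `DifferenceBodyFloor` contradict `|H| ≤ 3^{(1+ε)N}`. -/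
def PowerHosting : Prop :=
  ∀ (N k : ℕ) (H : Type) [AddCommGroup H] [Fintype H] (α β γ : (Fin N → Fin 3) → H),
    (∀ x y z : Fin N → Fin 3, α x + β y + γ z = 0 ↔ ∀ i, x i ≠ y i ∧ x i ≠ z i ∧ y i ≠ z i) →
    ∃ α' β' γ' : (Fin (k * N) → Fin 3) → (Fin k → H),
      ∀ x y z : Fin (k * N) → Fin 3, α' x + β' y + γ' z = 0 ↔ ∀ i, x i ≠ y i ∧ x i ≠ z i ∧ y i ≠ z i

/-- The typed target of the line (negation lens): the two stubs and the two glue lemmas refute the crux. -/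
def Kill : Prop := Thinning → DifferenceBodyFloor → PairsOfHosting → PowerHosting → ¬ HostingRateThree

/-- the sharp law implies the floor (with `κ = log₃4 − 1`, `C = log₃(4/3)`, `c = 1`). -/
theorem differenceBodyFloor_of_law (h : DifferenceBodyLaw) : DifferenceBodyFloor := by
  refine ⟨Real.logb 3 4 - 1, ?_, Real.logb 3 (4 / 3), ?_, 1, one_pos, ?_⟩
  · have : (1 : ℝ) < Real.logb 3 4 := by
      rw [Real.lt_logb_iff_rpow_lt (by norm_num) (by norm_num)]
      norm_num
    linarith
  · exact Real.logb_nonneg (by norm_num) (by norm_num)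
  · intro N H _ _ p q hc
    have h4 := h N H p q hc
    have : (3 : ℝ) ^ ((1 + (Real.logb 3 4 - 1)) * N) = (4 : ℝ) ^ N := by
      have : (1 + (Real.logb 3 4 - 1)) = Real.logb 3 4 := by ring
      rw [this, Real.rpow_mul (by norm_num), Real.rpow_logb (by norm_num) (by norm_num) (by norm_num),
        Real.rpow_natCast]
    rw [one_mul, this]
    exact h4

/-! ### Thinning, decomposed: one named fact (Strassen 1991 / CVZ 2018 Thm 4.4) + BCCGNSU Thm 4.14 (PROVED in tree) -/

/-- NAMED FACT (Strassen 1991, "Degeneration and complexity of bilinear maps", via the Coppersmith–Winograd method;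
= Christandl–Vrana–Zuiddam 2018 Thm 4.4 applied to the tight set `supp(xyz) = {permutations of (0,1,2)} ⊆ {x+y+z=3}`
with the uniform distribution on the six permutations): the `N`-th power of the permutation support contains FREE
DIAGONALS of size `3^{(1-ε)N}`.  Not in the tree; to be filed as a Literature fact. -/
def FreeDiagonalXYZ : Prop :=
  ∀ ε : ℝ, 0 < ε → ∃ N₀ : ℕ, ∀ N : ℕ, N₀ ≤ N → ∃ (m : ℕ) (x y z : Fin m → (Fin N → Fin 3)),
    (3 : ℝ) ^ ((1 - ε) * N) ≤ m ∧
    ∀ i j k : Fin m, (∀ c, x i c ≠ y j c ∧ x i c ≠ z k c ∧ y j c ≠ z k c) ↔ (i = j ∧ j = k)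

/-- glue (proved): a free diagonal of the permutation support, pushed through a free hosting, is a tricolored
sum-free set in `H` of the same size (so `BCCGNSU2017_thm414` bounds it by `3|H|·J(q)^{n_q}` for every prime-power
direct factor multiplicity `n_q` of `H`). -/
theorem tricolored_of_freeDiagonal {N m : ℕ} {H : Type} [AddCommGroup H] (α β γ : (Fin N → Fin 3) → H)
    (hαβγ : ∀ x y z : Fin N → Fin 3, α x + β y + γ z = 0 ↔ ∀ i, x i ≠ y i ∧ x i ≠ z i ∧ y i ≠ z i)
    (x y z : Fin m → (Fin N → Fin 3))
    (hd : ∀ i j k : Fin m, (∀ c, x i c ≠ y j c ∧ x i c ≠ z k c ∧ y j c ≠ z k c) ↔ (i = j ∧ j = k)) :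
    Literature.Combinatorics.Additive.IsTricoloredSumFree (α ∘ x) (β ∘ y) (γ ∘ z) := by
  intro i j k
  simp only [Function.comp]
  rw [hαβγ, hd]

/-- bookkeeping target for the Thinning stub: with `FreeDiagonalXYZ` and Thm 4.14 (`bccgnsuJ q ≤ e^{-δ}` uniformly,
`bccgnsuJ_le_exp_neg_delta`), every prime-power multiplicity satisfies `n_q(H) ≤ C·(ε N + log N)`, and with
`Σ_k k·n_{3^k} ≤ log₃|H|` this gives `r₃(H) = Σ_k n_{3^k} ≤ O(√ε)·N`, i.e. `Thinning`. -/
def ThinningFromFacts : Prop := FreeDiagonalXYZ → Thinning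

end Summit.MatrixMultiplication.MatrixMultiplication.Cruxes.HostingRateThree.DifferenceBody
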